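import Mathlib.Combinatorics.SetFamily.HarrisKleitman
import Mathlib.Tactic.Positivity
import Mathlib.Algebra.BigOperators.Ring.Finset
import HarnessLib

/-!
# Crux `PercNearOneGluing.AdditiveGluing` (stmt-CriticalPhenomena-4576): Harris–Kleitman across a complementary pair ("poly-Harris")

Support file (`--supports stmt-CriticalPhenomena-4576`, helper; depth seat (d) exchange-certificate form, gen g4).  No definitions, no named
facts, no sorries.

The fibre / tensor-Bernstein programme for the kernel `stub_k0CovTransferQ_c9` (lead c12's (CNT), `covTransferQ_of_fibres`; this seat's (CNT_SD),
memo EXCHCERT-g6 / FIBRE-PROBLEM on the item) reduces every two-replica piece of a fibre count to a statement about a uniformly random subset `S`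
of the SOLO coordinates together with its COMPLEMENT `Sᶜ` (the other replica).  The first rung of that programme — the only one proved so far —
is Harris' inequality in this complementary-pair form: for up-sets `𝒜, ℬ` of `Finset α`,

  `#{S ∈ 𝒜 : Sᶜ ∈ ℬ} ≤ #(𝒜 ∩ ℬ)`,

i.e. the coefficient of every monomial in `M_{𝒜∩ℬ}(x)·M_1(x) − M_𝒜(x)·M_ℬ(x)` (generating polynomials of up-sets) is non-negative; it is the
Harris-Q part of the plain cluster covariance transfer (CT₀) read fibrewise.  Proof: `S ↦ Sᶜ` maps `ℬ` onto a LOWER set `ℬ'` of the same size, and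
Kleitman's lemma (Mathlib `IsUpperSet.le_card_inter_finset`, `IsUpperSet.card_inter_le_finset`) gives
`2^|α|·#(𝒜 ∩ ℬ') ≤ #𝒜·#ℬ' = #𝒜·#ℬ ≤ 2^|α|·#(𝒜 ∩ ℬ)`.
[cite: Kleitman1966, Lemma (families of subsets; J. Combin. Theory 1 (1966) 153–155)] [folklore]
-/

namespace Summit.CriticalPhenomena.PercolationContinuityZ3.Theorems

open Finset

variable {α : Type*} [DecidableEq α] [Fintype α]

/-- The image of a family under complementation `S ↦ Sᶜ`. [folklore] -/
theorem ComplementaryPairHarris.mem_image_compl {ℬ : Finset (Finset α)} {S : Finset α} :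
    S ∈ ℬ.image (fun T => Tᶜ) ↔ Sᶜ ∈ ℬ := by
  constructor
  · rintro h
    obtain ⟨T, hT, rfl⟩ := mem_image.1 h
    simpa only [compl_compl] using hT
  · intro h
    exact mem_image.2 ⟨Sᶜ, h, compl_compl S⟩

/-- Complementation maps an upper family to a lower family. [folklore] -/
theorem ComplementaryPairHarris.isLowerSet_image_compl {ℬ : Finset (Finset α)}
    (hℬ : IsUpperSet (ℬ : Set (Finset α))) : IsLowerSet ((ℬ.image (fun T => Tᶜ) : Finset (Finset α)) : Set (Finset α)) := by
  intro S T hTS hS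
  rw [mem_coe, ComplementaryPairHarris.mem_image_compl] at hS ⊢
  exact hℬ (compl_subset_compl.2 hTS) hS

/-- Complementation is injective on families, so the image has the same size. [folklore] -/
theorem ComplementaryPairHarris.card_image_compl (ℬ : Finset (Finset α)) : (ℬ.image (fun T : Finset α => Tᶜ)).card = ℬ.card :=
  card_image_of_injective _ (fun _ _ h => compl_injective h)

/-- **Harris across a complementary pair (Kleitman).**  For upper families `𝒜, ℬ` of subsets of a finite type,
`#{S ∈ 𝒜 : Sᶜ ∈ ℬ} ≤ #(𝒜 ∩ ℬ)`: a uniformly random set is at least as likely to lie in `𝒜` and `ℬ` simultaneously as to lie in `𝒜`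
while its complement lies in `ℬ`.  (Fibrewise / coefficientwise form of Harris' inequality; the first rung of the fibre programme for the
kernel (T) of the crux.) [cite: Kleitman1966, Lemma] -/
theorem complementaryPair_harris (𝒜 ℬ : Finset (Finset α)) (h𝒜 : IsUpperSet (𝒜 : Set (Finset α)))
    (hℬ : IsUpperSet (ℬ : Set (Finset α))) :
    (𝒜.filter (fun S => Sᶜ ∈ ℬ)).card ≤ (𝒜 ∩ ℬ).card := by
  set ℬ' : Finset (Finset α) := ℬ.image (fun T => Tᶜ) with hℬ'
  have hfilter : 𝒜.filter (fun S => Sᶜ ∈ ℬ) = 𝒜 ∩ ℬ' := by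
    ext S
    simp only [mem_filter, mem_inter, hℬ', ComplementaryPairHarris.mem_image_compl]
  rw [hfilter]
  have hlow : IsLowerSet (ℬ' : Set (Finset α)) := ComplementaryPairHarris.isLowerSet_image_compl hℬ
  -- Kleitman: upper ∩ lower is small, upper ∩ upper is large
  have h1 : 2 ^ Fintype.card α * (𝒜 ∩ ℬ').card ≤ 𝒜.card * ℬ'.card := h𝒜.card_inter_le_finset hlow
  have h2 : 𝒜.card * ℬ.card ≤ 2 ^ Fintype.card α * (𝒜 ∩ ℬ).card := h𝒜.le_card_inter_finset hℬ
  have hcard : ℬ'.card = ℬ.card := ComplementaryPairHarris.card_image_compl ℬ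
  rw [hcard] at h1
  have hpos : 0 < 2 ^ Fintype.card α := Nat.pos_of_ne_zero (by simp)
  exact Nat.le_of_mul_le_mul_left (h1.trans h2) hpos

/-- Signed-count form: `0 ≤ Σ_S (1[S ∈ 𝒜 ∩ ℬ] − 1[S ∈ 𝒜 ∧ Sᶜ ∈ ℬ])` over all subsets `S` — the coefficient of a monomial of the solo
coordinates in `M_{𝒜∩ℬ}·M_1 − M_𝒜·M_ℬ`. [cite: Kleitman1966, Lemma] -/
theorem complementaryPair_harris_sum (𝒜 ℬ : Finset (Finset α)) (h𝒜 : IsUpperSet (𝒜 : Set (Finset α)))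
    (hℬ : IsUpperSet (ℬ : Set (Finset α))) :
    0 ≤ ∑ S : Finset α, ((if S ∈ 𝒜 ∧ S ∈ ℬ then (1 : ℤ) else 0) - (if S ∈ 𝒜 ∧ Sᶜ ∈ ℬ then (1 : ℤ) else 0)) := by
  rw [Finset.sum_sub_distrib, sub_nonneg, Finset.sum_boole, Finset.sum_boole]
  have hA : (Finset.univ.filter fun S : Finset α => S ∈ 𝒜 ∧ Sᶜ ∈ ℬ) = 𝒜.filter (fun S => Sᶜ ∈ ℬ) := by
    ext S; simp only [mem_filter, mem_univ, true_and]
  have hB : (Finset.univ.filter fun S : Finset α => S ∈ 𝒜 ∧ S ∈ ℬ) = 𝒜 ∩ ℬ := by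
    ext S; simp only [mem_filter, mem_univ, true_and, mem_inter]
  rw [hA, hB]
  exact_mod_cast complementaryPair_harris 𝒜 ℬ h𝒜 hℬ

end Summit.CriticalPhenomena.PercolationContinuityZ3.Theorems
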